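import Summits.QuantumFields.YangMills.Theorems.BalabanUVNodesN11TStepInnerCentralWindowChartAtRegions
import Summits.QuantumFields.YangMills.Theorems.BalabanUVNodesN11TStepGraphIntegrableOfProvisos

/-!
# DAG node N11 — THE KERNEL-LEVEL LEFT SIDE OF (O3′) AT def-R's REGIONS OF RECORD FROM THE CORE PROVISOS: at a v1.7 parameter `θ` with `θ.Provisos₁₃CoPH`, the represented
# tower's pre-𝐑 slots ∀ `s` = `𝐓^{(k)}[∫ inner central-window chart integral]` a.e., with the rows `hw ∕ hwj ∕ hχ ∕ hG` DISCHARGED — displayed: the α-guards, ONE measurability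
# row (`slot_k`) and the SUPPORT CLAUSE only

HEADER — WORK-UNIT METADATA.  Cell `pub-ymgap`, YM-PLAN Track A (HUMAN RULING D-0062), seat `pub-ymgap-dag-n08-w2` (g9; WIDTH SEAT 2∕4 on N08 [B10], RE-POINTED to
N11's [III] §3-supply residue), route `BalabanUVNodes`, key item K1⁷ `StabilityBAtRecordR13SepCoPH` = stmt-QuantumFields-20542 (helper lane, `--kind proof --supports 20542
--as helper` — jail key; K1⁹ stmt-QuantumFields-27364 is the K1-face of record, mis-key rule; count-neutral; (B4)-socket bookkeeping).  [III] = [Balaban1988Convergent].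
FILE 13 of this seat's kernel-level socket = FILE 12 `…N11TStepInnerCentralWindowChartAtRegions` (§3 ★★ `exists_ae_forall_slotsTOfRecord₁₃H_succ_eq_kernelRTOfRecord_innerCentralWindow_atRegions`)
with its rows discharged BY NAME from def-T v1.7's core provisos: `Node00/Record13CoPH` (`Stage13HParams.Provisos₁₃CoPH.tstep`: rows `measW`, `measChi`), def-T's
`Node00/TStepOfRecord` (`chiSeqOfRecord_zero`: `χ_0 ≡ 1`), and dag-n11-w2 g4's p628852 `…N11TStepGraphIntegrableOfProvisos` (★★ `hG_at_record₁₃_of_provisos`: the graph-integrability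
row is a theorem of the core provisos).  CONSUMED BY NAME, nothing modified.

WHY THIS FILE.  FILE 12 §3 displays, beside the three numeric α-guards and the support clause, four rows: `hw`∕`hwj` (measurable sections ∕ joint measurability of def-K0a's
step weights of record), `hχ` (measurability of `χ_k(s₀)`), `hslot` (measurability of `slot_k(s₀)`) and `hGi` (GRAPH integrability of the slot integrands).  At a v1.7 parameter
carrying `θ.Provisos₁₃CoPH` — what every consumer of the (O3′) road holds — three of them are theorems: `hwj` is row `measW` of `h.tstep p k hk` (and `hw` its `U`-section),
`hχ` is row `measChi` of `h.tstep p (k−1) _` for `k ≥ 1` and `χ_0 ≡ 1` at `k = 0`, `hGi` is dag-n11-w2's ★★.  So the kernel-level LEFT side of (O3′) at print's own regions reads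
from `θ.Provisos₁₃CoPH` + ONE row (`hslot`, K0c's `Stage9Params.measurable_slotsOfRecord_of_localBg_hist` under (H-U)) + the SUPPORT CLAUSE (background-regularity content) ONLY.

WHAT THIS FILE PROVES (0 `def`, 0 `sorry`, standard axioms).
§1 `measurable_chiSeqOfRecord₁₃_of_provisos` (level-`k` front factors measurable along the ₁₃ histories, `k < K`, from the core provisos: `k = 0` by `χ_0 ≡ 1`, `k ≥ 1` by row `measChi`).
§2 ★★★ `exists_ae_forall_slotsTOfRecord₁₃H_succ_eq_kernelRTOfRecord_atRegions_of_provisos` · ★ `exists_ae_forall_slotsTOfRecord₁₃H_succ_eq_kernelRTOfRecord_atRegions_of_provisos_of_plaqSmall`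
(support clause in PLAQUETTE currency).

HONEST FRAMING.  Helper lane of K1⁷ (aside key); count-neutral; by-name composition (FILE 12 + def-T rows + dag-n11-w2's ★★); the SUPPORT CLAUSE on the coarse bonds meeting
`Ω_{k+1}(s)` (what the (3.2)–(3.5) factors of `w_k(s)` are meant to give — NOT derived: background-regularity content, dag-n11-w6's (o4) LOCATED) and the row `hslot` REMAIN
HYPOTHESES, displayed; `θ.Provisos₁₃CoPH` is a HYPOTHESIS (no v1.7 parameter is claimed to carry it here); the Jacobian is a Radon–Nikodym VERSION; NO chart of Bałaban's ((47), [III]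
(3.10)–(3.25)) asserted; nothing of Bałaban ([I] §2, [III] §3, Thm 1–2) asserted; (B4)∕(S-α)∕(O3′) NOT closed; N11 NOT discharged; N08 untouched; K1⁷∕K1⁸∕K1⁹ NOT closed, no
registered stub touched; counts unmoved (typed 28∕28 · discharged 5∕27 · A 5∕28).  One finite `𝕋⁴_{L^K}` programme at fixed `ε = L^{−K}`; R4 closes only the conditional
finite-𝕋⁴ rung `BalabanLadder.UV` — NOT ℝ⁴, NOT OS, NOT a mass gap, NOT Clay.  No `sorry`, `axiom`, `def`, `instance`, `notation`.
Sources (SHAPE ∕ bookkeeping only): [III] (2.17)–(2.18) p.257, (2.21) p.258, (3.1) p.264, (3.2)–(3.9) pp.265–266, (3.16) p.268, p.267 L18–24, (3.24)–(3.25) p.270.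
-/

noncomputable section

open MeasureTheory ProbabilityTheory Set Function
open scoped ENNReal NNReal

namespace Summit.QuantumFields.YangMills.Theorems.BalabanUVNodesN11TStepInnerCentralWindowChartAtRegionsOfProvisos

open Literature.MathematicalPhysics.QuantumFieldTheory.Balaban1983to89
open Literature.MathematicalPhysics.QuantumFieldTheory.Balaban1983to89.T4AveragingDisintegration
open Literature.MathematicalPhysics.QuantumFieldTheory.Balaban1983to89.BlockAveraging (Small Idx avgFun loopHol)
open Literature.MathematicalPhysics.QuantumFieldTheory.Balaban1983to89.BlockAveragingHaarAC (centralBond pre post centralBond_injective isLocal_avgFun)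
open Literature.MathematicalPhysics.QuantumFieldTheory.Balaban1983to89.BlockAveragingEMLHaarAC (fibreFamily offCard)
open Literature.MathematicalPhysics.QuantumFieldTheory.Balaban1983to89.ExpMeanLog (expMeanLogSU deltaSU)
open BalabanUVNodesN11TStepInnerCentralWindowChartAtRegions BalabanUVNodesN11PrivateChartOfCentralWindow
open BalabanUVNodesN11TransportOfRecordInPrivateCoordinateChart (succ_le_m_add_K)
open BalabanUVNodesN11TStepGraphIntegrableOfProvisos (hG_at_record₁₃_of_provisos)

open Node00 hiding SU
open T4Continuum
open B10Eq42TorusConstraint (bondsIn)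
open B10Eq38TorusDomains (toFine)

variable {F : T4Family} {N : ℕ} [NeZero N] (p : B12.RunParams) {k : ℕ}

/-! ## §1  The level-`k` front factors are measurable along the ₁₃ histories, from the core provisos -/

/-- **ROW `hχ` FROM THE CORE PROVISOS**: at a v1.7 parameter with `θ.Provisos₁₃CoPH`, `k < K`, every level-`k` front factor `χ_k(s₀)` of record is measurable — at `k = 0` it is the
constant `1` (def-T's `chiSeqOfRecord_zero`: no (2.17) cube is constrained before the first step), at `k = k′+1` it is row `measChi` of def-T's step provisos `h.tstep p k′ _`.
[cite: Balaban1988Convergent, (2.17)–(2.18) p.257, (3.2) p.265 (bookkeeping)] -/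
theorem measurable_chiSeqOfRecord₁₃_of_provisos (θ : Stage13HParams F N) (h : θ.Provisos₁₃CoPH F N) (hk : k < p.K)
    (s₀ : SeqOfRecord F θ.ν θ.τ9.M (gOfRecord₁₃ F N θ.toStage13Params p) p.K k) :
    Measurable (chiSeqOfRecord F N θ.ν θ.τ9.M (gOfRecord₁₃ F N θ.toStage13Params p) p.K k s₀) := by
  cases k with
  | zero =>
    have h1 : chiSeqOfRecord F N θ.ν θ.τ9.M (gOfRecord₁₃ F N θ.toStage13Params p) p.K 0 s₀ = fun _ => 1 :=
      funext fun V => chiSeqOfRecord_zero F N θ.ν θ.τ9.M (gOfRecord₁₃ F N θ.toStage13Params p) p.K s₀ V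
    rw [h1]
    exact measurable_const
  | succ k' => exact (h.tstep p k' (Nat.lt_of_succ_lt hk)).measChi s₀

/-! ## §2  The kernel-level LEFT side of (O3′) at def-R's regions of record, from the core provisos -/

/-- **★★★ THE REPRESENTED TOWER'S PRE-𝐑 SLOTS AT LEVEL k+1 AT def-R's REGIONS OF RECORD, SEPARATED, EVERY HISTORY AT ONCE, FROM THE CORE PROVISOS**: at a v1.7 parameter
`θ` with `h : θ.Provisos₁₃CoPH F N`, step `k < p.K`, `0 ≤ α ≤ 1∕24`, `α < δ_N`, `offCard c∕|Idx| + 150α < 1`, ONE measurability row (`slot_k(s₀)` measurable) and the SUPPORT CLAUSE on the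
coarse bonds meeting `Ω_{k+1}(s)` «`w_k(s)(U, V′) ≠ 0 ⇒ ∀ c ∉ bondsIn (k+1) (Ω_{k+1}(s))ᶜ, ∀ i, dist1 (loopHol U c i) ≤ α`»: THERE ARE jointly measurable `(T, ϑ, jd)` such that for
`dV′`-a.e. `V′` and EVERY length-(k+1) history `s`, `slotsT_{k+1}(s)(V′) = kernelRTOfRecord F N K k (bondsIn k (Ω_{k+1}(s))ᶜ).toFinset (bondsIn (k+1) (Ω_{k+1}(s))ᶜ).toFinset
[y ↦ ∫ dU_in 𝟙·∏ jd · (w_k(s)(·,V′)·χ_k(init s)·slot_k(init s))(e(y, extend β′ (ϑ_c(·, r c))_c U_in))] o` — FILE 12 ★★ with `hw`∕`hwj` := row `measW` of `h.tstep p k hk`, `hχ` := §1,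
`hGi` := dag-n11-w2's ★★ `hG_at_record₁₃_of_provisos`.  The LEFT side of N11's 𝐓-present child obligation (O3′) in 11a's `genDataOfRecord` currency, read from the core provisos.
[cite: Balaban1988Convergent, (2.18) p.257, (2.21) p.258, (3.1) p.264, (3.2)–(3.9) pp.265–266, (3.16) p.268, p.267 L18–24, (3.24)–(3.25) p.270] -/
theorem exists_ae_forall_slotsTOfRecord₁₃H_succ_eq_kernelRTOfRecord_atRegions_of_provisos (θ : Stage13HParams F N) (h : θ.Provisos₁₃CoPH F N) (hk : k < p.K)
    {α : ℝ} (hα0 : 0 ≤ α) (hα : α ≤ 1 / 24) (hαδ : α < deltaSU (Fin N))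
    (hgap : ∀ c : PBond (F.P p.K) (k + 1), (offCard c : ℝ) / (Fintype.card (Idx (F.P p.K)) : ℝ) + 150 * α < 1)
    (hslot : ∀ s₀ : SeqOfRecord F θ.ν θ.τ9.M (gOfRecord₁₃ F N θ.toStage13Params p) p.K k,
      Measurable (slotsOfRecord F N θ.ν θ.τ9 (EOfRecord₁₃ F N θ.toStage13Params) (wOfRecord₉ F N θ.toStage9Params) θ.ppSel p (gOfRecord₁₃ F N θ.toStage13Params p) k s₀))
    (hwS : ∀ (s : SeqOfRecord F θ.ν θ.τ9.M (gOfRecord₁₃ F N θ.toStage13Params p) p.K (k + 1)) (U : GaugeField (F.P p.K) k (SU N))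
      (V' : GaugeField (F.P p.K) (k + 1) (SU N)),
      wOfRecord₉ F N θ.toStage9Params p (gOfRecord₁₃ F N θ.toStage13Params p) k s U V' ≠ 0 →
        ∀ c : PBond (F.P p.K) (k + 1), c ∉ bondsIn (k + 1) (s.Ω (k + 1))ᶜ → ∀ i : Idx (F.P p.K), dist1 (loopHol U c i) ≤ α) :
    ∃ (T : PBond (F.P p.K) (k + 1) → GaugeField (F.P p.K) k (SU N) → Set (SU N))
      (ϑ : PBond (F.P p.K) (k + 1) → GaugeField (F.P p.K) k (SU N) → SU N → SU N)
      (jd : PBond (F.P p.K) (k + 1) → GaugeField (F.P p.K) k (SU N) → SU N → ℝ≥0),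
      (∀ c, MeasurableSet {q : GaugeField (F.P p.K) k (SU N) × SU N | q.2 ∈ T c q.1}) ∧
      (∀ c, Measurable fun q : GaugeField (F.P p.K) k (SU N) × SU N => ϑ c q.1 q.2) ∧
      (∀ c, Measurable fun q : GaugeField (F.P p.K) k (SU N) × SU N => jd c q.1 q.2) ∧
      ∀ᵐ V' ∂(fieldMeasure (F.P p.K) (k + 1) (SU N)), ∀ s : SeqOfRecord F θ.ν θ.τ9.M (gOfRecord₁₃ F N θ.toStage13Params p) p.K (k + 1),
        slotsTOfRecord F N θ.ν θ.τ9 (EOfRecord₁₃ F N θ.toStage13Params) (wOfRecord₉ F N θ.toStage9Params) θ.ppSel p (gOfRecord₁₃ F N θ.toStage13Params p) (k + 1) s V' =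
          kernelRTOfRecord F N p.K k (Set.toFinite (bondsIn k (s.Ω (k + 1))ᶜ)).toFinset (Set.toFinite (bondsIn (k + 1) (s.Ω (k + 1))ᶜ)).toFinset
            (fun y => ∫ uin,
              (({z : ((↥(Set.toFinite (bondsIn k (s.Ω (k + 1))ᶜ)).toFinset → SU N) ×
                    ({c : PBond (F.P p.K) (k + 1) // c ∉ (Set.toFinite (bondsIn (k + 1) (s.Ω (k + 1))ᶜ)).toFinset} → SU N)) ×
                    ({b : PBond (F.P p.K) k // b ∉ (Set.toFinite (bondsIn k (s.Ω (k + 1))ᶜ)).toFinset} → SU N) |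
                  ∀ c : {c : PBond (F.P p.K) (k + 1) // c ∉ (Set.toFinite (bondsIn (k + 1) (s.Ω (k + 1))ᶜ)).toFinset},
                    z.1.2 c ∈ T c ((MeasurableEquiv.piEquivPiSubtypeProd (fun _ : PBond (F.P p.K) k => SU N)
                      (· ∈ (Set.toFinite (bondsIn k (s.Ω (k + 1))ᶜ)).toFinset)).symm (z.1.1, z.2))}.indicator
                (fun z => ∏ c : {c : PBond (F.P p.K) (k + 1) // c ∉ (Set.toFinite (bondsIn (k + 1) (s.Ω (k + 1))ᶜ)).toFinset},
                  jd c ((MeasurableEquiv.piEquivPiSubtypeProd (fun _ : PBond (F.P p.K) k => SU N)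
                    (· ∈ (Set.toFinite (bondsIn k (s.Ω (k + 1))ᶜ)).toFinset)).symm (z.1.1, z.2)) (z.1.2 c))
                ((y, (MeasurableEquiv.piEquivPiSubtypeProd (fun _ : PBond (F.P p.K) (k + 1) => SU N)
                  (· ∈ (Set.toFinite (bondsIn (k + 1) (s.Ω (k + 1))ᶜ)).toFinset) V').2), uin) : ℝ≥0) : ℝ) *
              ((fun U : GaugeField (F.P p.K) k (SU N) =>
                  wOfRecord₉ F N θ.toStage9Params p (gOfRecord₁₃ F N θ.toStage13Params p) k s U V' *
                    (chiSeqOfRecord F N θ.ν θ.τ9.M (gOfRecord₁₃ F N θ.toStage13Params p) p.K k s.init U *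
                      slotsOfRecord F N θ.ν θ.τ9 (EOfRecord₁₃ F N θ.toStage13Params) (wOfRecord₉ F N θ.toStage9Params) θ.ppSel p
                        (gOfRecord₁₃ F N θ.toStage13Params p) k s.init U))
                ((MeasurableEquiv.piEquivPiSubtypeProd (fun _ : PBond (F.P p.K) k => SU N)
                  (· ∈ (Set.toFinite (bondsIn k (s.Ω (k + 1))ᶜ)).toFinset)).symm (y,
                  extend (fun c : {c : PBond (F.P p.K) (k + 1) // c ∉ (Set.toFinite (bondsIn (k + 1) (s.Ω (k + 1))ᶜ)).toFinset} =>
                      (⟨centralBond (c : PBond (F.P p.K) (k + 1)), centralBond_not_mem_bondsInFinset_compl_Omega hk s c c.2⟩ :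
                        {b : PBond (F.P p.K) k // b ∉ (Set.toFinite (bondsIn k (s.Ω (k + 1))ᶜ)).toFinset}))
                    (fun c : {c : PBond (F.P p.K) (k + 1) // c ∉ (Set.toFinite (bondsIn (k + 1) (s.Ω (k + 1))ᶜ)).toFinset} =>
                      ϑ c ((MeasurableEquiv.piEquivPiSubtypeProd (fun _ : PBond (F.P p.K) k => SU N)
                        (· ∈ (Set.toFinite (bondsIn k (s.Ω (k + 1))ᶜ)).toFinset)).symm (y, uin))
                        ((MeasurableEquiv.piEquivPiSubtypeProd (fun _ : PBond (F.P p.K) (k + 1) => SU N)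
                          (· ∈ (Set.toFinite (bondsIn (k + 1) (s.Ω (k + 1))ᶜ)).toFinset) V').2 c)) uin)))
              ∂(Measure.pi fun _ : {b : PBond (F.P p.K) k // b ∉ (Set.toFinite (bondsIn k (s.Ω (k + 1))ᶜ)).toFinset} => (HaarData.haar : Measure (SU N))))
            (MeasurableEquiv.piEquivPiSubtypeProd (fun _ : PBond (F.P p.K) (k + 1) => SU N)
              (· ∈ (Set.toFinite (bondsIn (k + 1) (s.Ω (k + 1))ᶜ)).toFinset) V').1 := by
  have hT := h.tstep p k hk
  exact exists_ae_forall_slotsTOfRecord₁₃H_succ_eq_kernelRTOfRecord_innerCentralWindow_atRegions p θ hk hα0 hα hαδ hgap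
    (fun s V' => Measurable.of_uncurry_left
      (f := fun (V' : GaugeField (F.P p.K) (k + 1) (SU N)) (U : GaugeField (F.P p.K) k (SU N)) =>
        wOfRecord₉ F N θ.toStage9Params p (gOfRecord₁₃ F N θ.toStage13Params p) k s U V') (hT.measW s)) hT.measW
    (fun s₀ => measurable_chiSeqOfRecord₁₃_of_provisos p θ h hk s₀) hslot hwS
    (fun s => hG_at_record₁₃_of_provisos θ h p hk s)

/-- **★ THE SAME WITH THE SUPPORT CLAUSE IN PLAQUETTE CURRENCY**: wherever `w_k(s)(U, V′) ≠ 0`, at every coarse bond `c ∉ bondsIn (k+1) (Ω_{k+1}(s))ᶜ` every fine plaquette based in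
the three blocks `B(c₋ − e_μ) ∪ B(c₋) ∪ B(c₊)` is within `δ` of `1`, `0 ≤ δ`, `((d+2)L)²∕4 · δ ≤ α` (p629018 `loops_small_of_plaqSmallOn_blocks` = pub-balaban's local Stokes bound).
[cite: Balaban1988Convergent, (2.17) p.257, (2.21) p.258, (3.1) p.264, (3.3) p.265, p.267 L18–24, (3.24)–(3.25) p.270; Balaban1987RG1, (0.4) p.253, (2.9) p.266] -/
theorem exists_ae_forall_slotsTOfRecord₁₃H_succ_eq_kernelRTOfRecord_atRegions_of_provisos_of_plaqSmall (θ : Stage13HParams F N) (h : θ.Provisos₁₃CoPH F N)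
    (hk : k < p.K) {α : ℝ} (hα0 : 0 ≤ α) (hα : α ≤ 1 / 24) (hαδ : α < deltaSU (Fin N))
    (hgap : ∀ c : PBond (F.P p.K) (k + 1), (offCard c : ℝ) / (Fintype.card (Idx (F.P p.K)) : ℝ) + 150 * α < 1)
    {δ : ℝ} (hδ : 0 ≤ δ) (hδα : ((((F.P p.K).d + 2) * (F.P p.K).L : ℕ) : ℝ) ^ 2 / 4 * δ ≤ α)
    (hslot : ∀ s₀ : SeqOfRecord F θ.ν θ.τ9.M (gOfRecord₁₃ F N θ.toStage13Params p) p.K k,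
      Measurable (slotsOfRecord F N θ.ν θ.τ9 (EOfRecord₁₃ F N θ.toStage13Params) (wOfRecord₉ F N θ.toStage9Params) θ.ppSel p (gOfRecord₁₃ F N θ.toStage13Params p) k s₀))
    (hwq : ∀ (s : SeqOfRecord F θ.ν θ.τ9.M (gOfRecord₁₃ F N θ.toStage13Params p) p.K (k + 1)) (U : GaugeField (F.P p.K) k (SU N))
      (V' : GaugeField (F.P p.K) (k + 1) (SU N)),
      wOfRecord₉ F N θ.toStage9Params p (gOfRecord₁₃ F N θ.toStage13Params p) k s U V' ≠ 0 →
        ∀ c : PBond (F.P p.K) (k + 1), c ∉ bondsIn (k + 1) (s.Ω (k + 1))ᶜ → ∀ q : Plaq (F.P p.K) k,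
          (blockOf q.src = c.src.unshift c.dir ∨ blockOf q.src = c.src ∨ blockOf q.src = c.tgt) → dist1 (GaugeField.plaqHol U q) < δ) :
    ∃ (T : PBond (F.P p.K) (k + 1) → GaugeField (F.P p.K) k (SU N) → Set (SU N))
      (ϑ : PBond (F.P p.K) (k + 1) → GaugeField (F.P p.K) k (SU N) → SU N → SU N)
      (jd : PBond (F.P p.K) (k + 1) → GaugeField (F.P p.K) k (SU N) → SU N → ℝ≥0),
      (∀ c, MeasurableSet {q : GaugeField (F.P p.K) k (SU N) × SU N | q.2 ∈ T c q.1}) ∧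
      (∀ c, Measurable fun q : GaugeField (F.P p.K) k (SU N) × SU N => ϑ c q.1 q.2) ∧
      (∀ c, Measurable fun q : GaugeField (F.P p.K) k (SU N) × SU N => jd c q.1 q.2) ∧
      ∀ᵐ V' ∂(fieldMeasure (F.P p.K) (k + 1) (SU N)), ∀ s : SeqOfRecord F θ.ν θ.τ9.M (gOfRecord₁₃ F N θ.toStage13Params p) p.K (k + 1),
        slotsTOfRecord F N θ.ν θ.τ9 (EOfRecord₁₃ F N θ.toStage13Params) (wOfRecord₉ F N θ.toStage9Params) θ.ppSel p (gOfRecord₁₃ F N θ.toStage13Params p) (k + 1) s V' =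
          kernelRTOfRecord F N p.K k (Set.toFinite (bondsIn k (s.Ω (k + 1))ᶜ)).toFinset (Set.toFinite (bondsIn (k + 1) (s.Ω (k + 1))ᶜ)).toFinset
            (fun y => ∫ uin,
              (({z : ((↥(Set.toFinite (bondsIn k (s.Ω (k + 1))ᶜ)).toFinset → SU N) ×
                    ({c : PBond (F.P p.K) (k + 1) // c ∉ (Set.toFinite (bondsIn (k + 1) (s.Ω (k + 1))ᶜ)).toFinset} → SU N)) ×
                    ({b : PBond (F.P p.K) k // b ∉ (Set.toFinite (bondsIn k (s.Ω (k + 1))ᶜ)).toFinset} → SU N) |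
                  ∀ c : {c : PBond (F.P p.K) (k + 1) // c ∉ (Set.toFinite (bondsIn (k + 1) (s.Ω (k + 1))ᶜ)).toFinset},
                    z.1.2 c ∈ T c ((MeasurableEquiv.piEquivPiSubtypeProd (fun _ : PBond (F.P p.K) k => SU N)
                      (· ∈ (Set.toFinite (bondsIn k (s.Ω (k + 1))ᶜ)).toFinset)).symm (z.1.1, z.2))}.indicator
                (fun z => ∏ c : {c : PBond (F.P p.K) (k + 1) // c ∉ (Set.toFinite (bondsIn (k + 1) (s.Ω (k + 1))ᶜ)).toFinset},
                  jd c ((MeasurableEquiv.piEquivPiSubtypeProd (fun _ : PBond (F.P p.K) k => SU N)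
                    (· ∈ (Set.toFinite (bondsIn k (s.Ω (k + 1))ᶜ)).toFinset)).symm (z.1.1, z.2)) (z.1.2 c))
                ((y, (MeasurableEquiv.piEquivPiSubtypeProd (fun _ : PBond (F.P p.K) (k + 1) => SU N)
                  (· ∈ (Set.toFinite (bondsIn (k + 1) (s.Ω (k + 1))ᶜ)).toFinset) V').2), uin) : ℝ≥0) : ℝ) *
              ((fun U : GaugeField (F.P p.K) k (SU N) =>
                  wOfRecord₉ F N θ.toStage9Params p (gOfRecord₁₃ F N θ.toStage13Params p) k s U V' *
                    (chiSeqOfRecord F N θ.ν θ.τ9.M (gOfRecord₁₃ F N θ.toStage13Params p) p.K k s.init U *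
                      slotsOfRecord F N θ.ν θ.τ9 (EOfRecord₁₃ F N θ.toStage13Params) (wOfRecord₉ F N θ.toStage9Params) θ.ppSel p
                        (gOfRecord₁₃ F N θ.toStage13Params p) k s.init U))
                ((MeasurableEquiv.piEquivPiSubtypeProd (fun _ : PBond (F.P p.K) k => SU N)
                  (· ∈ (Set.toFinite (bondsIn k (s.Ω (k + 1))ᶜ)).toFinset)).symm (y,
                  extend (fun c : {c : PBond (F.P p.K) (k + 1) // c ∉ (Set.toFinite (bondsIn (k + 1) (s.Ω (k + 1))ᶜ)).toFinset} =>
                      (⟨centralBond (c : PBond (F.P p.K) (k + 1)), centralBond_not_mem_bondsInFinset_compl_Omega hk s c c.2⟩ :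
                        {b : PBond (F.P p.K) k // b ∉ (Set.toFinite (bondsIn k (s.Ω (k + 1))ᶜ)).toFinset}))
                    (fun c : {c : PBond (F.P p.K) (k + 1) // c ∉ (Set.toFinite (bondsIn (k + 1) (s.Ω (k + 1))ᶜ)).toFinset} =>
                      ϑ c ((MeasurableEquiv.piEquivPiSubtypeProd (fun _ : PBond (F.P p.K) k => SU N)
                        (· ∈ (Set.toFinite (bondsIn k (s.Ω (k + 1))ᶜ)).toFinset)).symm (y, uin))
                        ((MeasurableEquiv.piEquivPiSubtypeProd (fun _ : PBond (F.P p.K) (k + 1) => SU N)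
                          (· ∈ (Set.toFinite (bondsIn (k + 1) (s.Ω (k + 1))ᶜ)).toFinset) V').2 c)) uin)))
              ∂(Measure.pi fun _ : {b : PBond (F.P p.K) k // b ∉ (Set.toFinite (bondsIn k (s.Ω (k + 1))ᶜ)).toFinset} => (HaarData.haar : Measure (SU N))))
            (MeasurableEquiv.piEquivPiSubtypeProd (fun _ : PBond (F.P p.K) (k + 1) => SU N)
              (· ∈ (Set.toFinite (bondsIn (k + 1) (s.Ω (k + 1))ᶜ)).toFinset) V').1 :=
  exists_ae_forall_slotsTOfRecord₁₃H_succ_eq_kernelRTOfRecord_atRegions_of_provisos p θ h hk hα0 hα hαδ hgap hslot fun s U V' hne c hc i =>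
    loops_small_of_plaqSmallOn_blocks (succ_le_m_add_K hk) hδ hδα U c (hwq s U V' hne c hc) i

end Summit.QuantumFields.YangMills.Theorems.BalabanUVNodesN11TStepInnerCentralWindowChartAtRegionsOfProvisos

end
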